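import Mathlib
import Literature.Analysis.FluidPDE.Tao2016AveragedNS.ViscousEternalSolutions
import Summits.NavierStokesRegularity.NavierStokesRegularity.Theorems.TaoLadderRungTwoBreakBlowupRigidityOneRenormalisedFlow
import HarnessLib

/-!
# The self-similar renormalisation of a VISCOUS cascade flow solves the eternal law WITH COVARIANT
  VISCOSITY (`IsEternalVisc.law`, `ν̂ = ν`) on the half-line `e^{-σ} < T` — the `ν ≥ 0` companion of
  `…RenormalisedFlow.renormalisedFlow_law`, for the maximal viscous flows of
  `BlowupRigidityOne.maximalViscousFlow_of_noGlobalCascade` (support for K2(1)/K2ᵛ(1):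
  stmt-NavierStokesRegularity-20206 `BlowupRigidityOne`, and the shared consequence-crux ⟨20420⟩)

MODEL lattice ODEs only (Tao 2016 §4, the viscous lattice before Thm. 4.2, in the self-similar variables of
§6.4); nothing here is a statement about the Navier–Stokes equations; NO item is closed (`--supports
stmt-NavierStokesRegularity-20206`). Route-independent; general `m`; any `ν : ℝ` (no sign needed for the
identity). Unlike the WakeRatchet extraction kit (`ClockedFrames.hasDerivAt_frame`, under the bundle
`Pinned` with `ν > 0` and the four pinning clauses), the statement here assumes ONLY the flow clauses
(`C¹` on `[0,T)` and the one-sided viscous law).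

* `hasDerivAt_of_viscousFlow`, `hasDerivAt_shellVec_of_viscousFlow` — interior derivatives of a viscous
  flow, shell vector in normal form `Λ^k • (Q x_k + Λ⁻¹•A x_{k-1} + B(x_{k+1},x_k)) - (ν(1+ε₀)^{2k}) • x_k`;
* `renormalisedViscousFlow_law` — for `W_n(σ) = (Λ^n e^{-σ}) • x_n(T - e^{-σ})`:
  `W_n' = -W_n + Q(W_n) + Λ A(W_{n-1}) + Λ⁻¹ B(W_{n+1}, W_n) - (ν (1+ε₀)^{2n} e^{-σ}) • W_n` at every `σ`
  with `e^{-σ} < T` — literally the `law` clause of `IsEternalVisc ε₀ ν α` there (the renormalised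
  viscosity `ν(1+ε₀)^{2n}e^{-σ}` is COVARIANT, `ViscousEternalSolutions`).
-/

noncomputable section

-- the summit and its single sub-problem share the name (CONVENTIONS §1)
set_option linter.dupNamespace false

open Set Filter Topology

namespace Summit.NavierStokesRegularity.NavierStokesRegularity.Theorems

namespace BlowupRigidityOne

open Literature.Analysis.FluidPDE Literature.Analysis.FluidPDE.TaoCascade
open DSSOneShift (hasDerivWithinAt_shellVec shellVec_quadTerm_normalForm)
open WakeRatchetCritical (tableQ_smul tableA_smul tableB_smul_smul)

variable {m : ℕ}

/-- Interior two-sided derivative of a component of a VISCOUS flow (`C¹` on `[0,T)`, one-sided law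
`derivWithin (X i k) [0,∞) t = quadTerm_{i,k}(X)(t) - ν(1+ε₀)^{2k} X_{i,k}(t)`).
[cite: Tao2016AveragedNS, §4 (the viscous equation before Thm. 4.2)] -/
theorem hasDerivAt_of_viscousFlow {ε₀ ν T : ℝ} {α : Fin m → Fin m → Fin m → ℤ × ℤ × ℤ → ℝ}
    {X : Fin m → ℤ → ℝ → ℝ} (hC1 : ∀ i n, ContDiffOn ℝ 1 (X i n) (Set.Ico 0 T))
    (hmot : ∀ i n t, 0 ≤ t → t < T → derivWithin (X i n) (Set.Ici 0) t =
      quadTerm ε₀ α X i n t - ν * (1 + ε₀) ^ ((2 : ℝ) * n) * X i n t)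
    (i : Fin m) (k : ℤ) {t : ℝ} (ht : t ∈ Ioo 0 T) :
    HasDerivAt (X i k) (quadTerm ε₀ α X i k t - ν * (1 + ε₀) ^ ((2 : ℝ) * k) * X i k t) t := by
  have hIco : Ico 0 T ∈ 𝓝 t := mem_of_superset (isOpen_Ioo.mem_nhds ht) Ioo_subset_Ico_self
  have hd : DifferentiableAt ℝ (X i k) t :=
    ((hC1 i k).differentiableOn one_ne_zero t (Ioo_subset_Ico_self ht)).differentiableAt hIco
  have h1 := hd.hasDerivAt
  have h2 : deriv (X i k) t = derivWithin (X i k) (Ici 0) t :=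
    (derivWithin_of_mem_nhds (Ici_mem_nhds ht.1)).symm
  rw [h2, hmot i k t ht.1.le ht.2] at h1
  exact h1

/-- The shell vector of a viscous flow is differentiable on `(0,T)`, derivative in normal form
`Λ^k • (Q(x_k) + Λ⁻¹ • A(x_{k-1}) + B(x_{k+1}, x_k)) - (ν(1+ε₀)^{2k}) • x_k`.
[cite: Tao2016AveragedNS, §4 (4.8) and the viscous equation before Thm. 4.2] -/
theorem hasDerivAt_shellVec_of_viscousFlow {ε₀ ν T : ℝ} (hε : 0 < ε₀)
    {α : Fin m → Fin m → Fin m → ℤ × ℤ × ℤ → ℝ}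
    {X : Fin m → ℤ → ℝ → ℝ} (hC1 : ∀ i n, ContDiffOn ℝ 1 (X i n) (Set.Ico 0 T))
    (hmot : ∀ i n t, 0 ≤ t → t < T → derivWithin (X i n) (Set.Ici 0) t =
      quadTerm ε₀ α X i n t - ν * (1 + ε₀) ^ ((2 : ℝ) * n) * X i n t)
    (k : ℤ) {t : ℝ} (ht : t ∈ Ioo 0 T) :
    HasDerivAt (shellVec X k)
      (bigLam ε₀ ^ k • (tableQ α (shellVec X k t) + (bigLam ε₀)⁻¹ • tableA α (shellVec X (k - 1) t)
        + tableB α (shellVec X (k + 1) t) (shellVec X k t))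
        - (ν * (1 + ε₀) ^ ((2 : ℝ) * k)) • shellVec X k t) t := by
  have hv : HasDerivWithinAt (shellVec X k)
      (WithLp.toLp 2 fun i => quadTerm ε₀ α X i k t - ν * (1 + ε₀) ^ ((2 : ℝ) * k) * X i k t) univ t :=
    hasDerivWithinAt_shellVec fun i => (hasDerivAt_of_viscousFlow hC1 hmot i k ht).hasDerivWithinAt
  have heq : (WithLp.toLp 2 fun i => quadTerm ε₀ α X i k t - ν * (1 + ε₀) ^ ((2 : ℝ) * k) * X i k t
      : Em m) = shellVec (fun i n s => quadTerm ε₀ α X i n s) k t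
        - (ν * (1 + ε₀) ^ ((2 : ℝ) * k)) • shellVec X k t := by
    ext i
    simp [shellVec, smul_eq_mul]
  rw [heq, shellVec_quadTerm_normalForm (by linarith) α X k t] at hv
  exact hasDerivWithinAt_univ.1 hv

/-- **THE RENORMALISED VISCOUS FLOW SOLVES THE ETERNAL LAW WITH COVARIANT VISCOSITY ON A HALF-LINE.**
Let `X` be a `ν`-viscous flow on `[0,T)` (`C¹` on `[0,T)`, one-sided law
`∂ₜX_{i,n} = quadTerm_{i,n}(X) - ν(1+ε₀)^{2n}X_{i,n}`), `ε₀ > 0`, and `W_n(σ) = (Λ^n e^{-σ}) • x_n(T - e^{-σ})`.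
Then at every `σ` with `e^{-σ} < T`:
`W_n' = -W_n + Q(W_n) + Λ A(W_{n-1}) + Λ⁻¹ B(W_{n+1}, W_n) - (ν (1+ε₀)^{2n} e^{-σ}) • W_n` — the `law`
clause of `IsEternalVisc ε₀ ν α` at that log-time (`ν = 0`: `renormalisedFlow_law`).
[cite: Tao2016AveragedNS, §6.4 with §4 (4.8) and the viscous equation before Thm. 4.2; cell vocabulary (`IsEternalVisc`)] -/
theorem renormalisedViscousFlow_law {ε₀ ν T : ℝ} (hε : 0 < ε₀)
    {α : Fin m → Fin m → Fin m → ℤ × ℤ × ℤ → ℝ}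
    {X : Fin m → ℤ → ℝ → ℝ} (hC1 : ∀ i n, ContDiffOn ℝ 1 (X i n) (Set.Ico 0 T))
    (hmot : ∀ i n t, 0 ≤ t → t < T → derivWithin (X i n) (Set.Ici 0) t =
      quadTerm ε₀ α X i n t - ν * (1 + ε₀) ^ ((2 : ℝ) * n) * X i n t)
    {W : ℤ → ℝ → Em m}
    (hW : ∀ n σ, W n σ = (bigLam ε₀ ^ n * Real.exp (-σ)) • shellVec X n (T - Real.exp (-σ)))
    (n : ℤ) {σ : ℝ} (hσ : Real.exp (-σ) < T) :
    HasDerivAt (W n)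
      (-((1 : ℝ) • W n σ) + tableQ α (W n σ) + bigLam ε₀ • tableA α (W (n - 1) σ)
        + (bigLam ε₀)⁻¹ • tableB α (W (n + 1) σ) (W n σ)
        - (ν * ((1 + ε₀) ^ ((2 : ℝ) * n) * Real.exp (-σ))) • W n σ) σ := by
  have hL : 0 < bigLam ε₀ := bigLam_pos (by linarith)
  have hLne : bigLam ε₀ ≠ 0 := hL.ne'
  set E : ℝ := Real.exp (-σ) with hEdef
  have hE : 0 < E := Real.exp_pos _
  have ht : T - E ∈ Ioo 0 T := ⟨by linarith, by linarith⟩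
  have hexp : HasDerivAt (fun v => Real.exp (-v)) (-E) σ := by
    have h := (Real.hasDerivAt_exp (-σ)).comp σ (hasDerivAt_neg σ)
    have e : Real.exp (-σ) * -1 = -E := by rw [hEdef]; ring
    rw [e] at h
    exact h
  have hθ : HasDerivAt (fun v => T - Real.exp (-v)) E σ := by
    have h := hexp.const_sub T
    rw [neg_neg] at h
    exact h
  set P2 : ℝ := (1 + ε₀) ^ ((2 : ℝ) * n) with hP2def
  set D : Em m := bigLam ε₀ ^ n • (tableQ α (shellVec X n (T - E))
    + (bigLam ε₀)⁻¹ • tableA α (shellVec X (n - 1) (T - E))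
    + tableB α (shellVec X (n + 1) (T - E)) (shellVec X n (T - E)))
    - (ν * P2) • shellVec X n (T - E) with hDdef
  have hS : HasDerivAt (fun v => shellVec X n (T - Real.exp (-v))) (E • D) σ := by
    have h := (hasDerivAt_shellVec_of_viscousFlow hε hC1 hmot n ht).scomp σ hθ
    simpa only [Function.comp_def] using h
  have hc : HasDerivAt (fun v => bigLam ε₀ ^ n * Real.exp (-v)) (bigLam ε₀ ^ n * -E) σ :=
    hexp.const_mul _
  have hprod := hc.smul hS
  have hfun : W n = fun v => (bigLam ε₀ ^ n * Real.exp (-v)) • shellVec X n (T - Real.exp (-v)) :=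
    funext fun v => hW n v
  have hder : HasDerivAt (W n) ((bigLam ε₀ ^ n * Real.exp (-σ)) • (E • D)
      + (bigLam ε₀ ^ n * -E) • shellVec X n (T - Real.exp (-σ))) σ := by
    rw [hfun]; exact hprod
  refine hder.congr_deriv ?_
  have hWn : W n σ = (bigLam ε₀ ^ n * E) • shellVec X n (T - E) := by rw [hW]
  have hWm : W (n - 1) σ = (bigLam ε₀ ^ (n - 1) * E) • shellVec X (n - 1) (T - E) := by rw [hW]
  have hWp : W (n + 1) σ = (bigLam ε₀ ^ (n + 1) * E) • shellVec X (n + 1) (T - E) := by rw [hW]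
  rw [← hEdef, hWn, hWm, hWp, tableQ_smul, tableA_smul, tableB_smul_smul, hDdef,
    zpow_sub_one₀ hLne, zpow_add_one₀ hLne]
  simp only [smul_add, smul_sub, smul_smul]
  match_scalars <;> field_simp
  -- the `x_n`-coefficient: `-(Eν P2) - 1 = -1 - Eν P2`
  ring

end BlowupRigidityOne

end Summit.NavierStokesRegularity.NavierStokesRegularity.Theorems

end
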